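import Summits.AtomisticToContinuum.HydrodynamicLimit.Theses.JParityClosure
import Summits.AtomisticToContinuum.HydrodynamicLimit.Theorems.JParityClosureParityBandClosureProductionZeroOfDetailedBalance
import Mathlib.MeasureTheory.Measure.ProbabilityMeasure
import Mathlib.MeasureTheory.Measure.FiniteMeasure
import Mathlib.MeasureTheory.Measure.FiniteMeasureProd
import HarnessLib

/-!
# Moments and the floor along weakly convergent sequences (stub `stub_momentSemicontinuity`)

Waypoint `MomentSemicontinuity` of the line `transfer-weighted-parity-chain` (skeleton v3) of the crux
`JParityClosure.ParityBandClosure` (stmt-AtomisticToContinuum-17608): the standard truncation /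
uniform-integrability facts along weakly convergent laws on `V3 = ℝ³` and finite records on
`Q = (ℝ³ × ℝ³) × S²`, as consumed by the Prokhorov/contradiction assembly `stub_parityStabilityOfRigidity`.

WHAT.  ν-part: along `ν_n → ν` weakly with `∫ |v|³ dν_n ≤ M`: (i) `∫ |v|³ dν ≤ M`; (ii) first and second
coordinate moments converge; (iii) for a nonneg bounded continuous `Ξ` on `Q` and the flux weight
`B q = hardSphereKernel (q.1.2, q.1.1) q.2 = ((w − v)·ω)₊`, the floor integral `∫ Ξ B d((ν ⊗ ν) ⊗ σ)`,
`σ = sphereMeasure`, is lower semicontinuous.  κ-part: second moments and mass `≤ M` pass to weak limits.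

PROOF.  Everything follows from ONE hypothesis on finite measures `μ_n, μ`: `∫ g dμ_n → ∫ g dμ` for all
bounded continuous `g`.  §1: lower semicontinuity for continuous `f ≥ 0` (each truncation `f ∧ k` is a
bounded continuous test, then monotone convergence `lintegral_iSup` in `k`), and transfer `∫ f dμ_n → ∫ f dμ`
when `f` is within `ε w` of a bounded continuous function for every `ε`, the weight `w` having uniformly
bounded integrals (`3ε` argument).  §2: on `ℝ³`, `|v_j|, |v_j v_k| ≤ 1 + |v|²` and a continuous radial
cutoff `χ_R` (`R ≥ 1`, `2/R ≤ ε`) gives `|f − f χ_R| ≤ (1 + |v|²) 𝟙_{|v| > R} ≤ ε |v|³`; `0 ≤ B ≤ |v| + |w|`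
(Cauchy–Schwarz, `‖ω‖ = 1`), so `Ξ B ≤ C (2 + |v|³ + |w|³)` is integrable on `(ν ⊗ ν) ⊗ σ`.  §3:
`ν_n ⊗ ν_n → ν ⊗ ν` (`ProbabilityMeasure.continuous_prod`) and, for the FIXED finite `σ`, Fubini reduces
`∫ g d(P_n ⊗ σ)` to `∫ G dP_n`, `G x = ∫ g (x, ω) dσ` bounded continuous (`continuous_of_dominated`).
§4: assembly; the mass bound is the continuity of `FiniteMeasure.mass`.

REFERENCES.  P. Billingsley, *Convergence of Probability Measures*, 2nd ed. (1999), Thm. 2.8, Thm. 3.4,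
Thm. 3.5; C. Cercignani, R. Illner, M. Pulvirenti, *The Mathematical Theory of Dilute Gases* (1994) §3.1.
-/

noncomputable section

namespace Summit.AtomisticToContinuum.HydrodynamicLimit.Theorems.ParityBandClosureMomentSemicontinuity

open scoped BigOperators Topology Classical MeasureTheory ENNReal InnerProductSpace
open Filter Set MeasureTheory
open Literature.MathematicalPhysics.KineticTheory Literature.Analysis.FluidPDE

/-- **Moments and the floor along weakly convergent sequences** (verbatim the skeleton's waypoint).  ν-part:
along `ν_n → ν` weakly with `∫|v|³dν_n ≤ M`: `∫|v|³dν ≤ M`, first and second coordinate moments converge,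
and `∫ Ξ B d((ν⊗ν)⊗σ)` is lower semicontinuous for nonneg bounded continuous `Ξ`.  κ-part: along `κ_n → κ`
weakly (finite measures on `Q`) second moments `≤ M` and mass `≤ M` pass to the limit. -/
def MomentSemicontinuity : Prop :=
  (∀ (M : ℝ) (νs : ℕ → ProbabilityMeasure V3) (ν : ProbabilityMeasure V3), Tendsto νs atTop (𝓝 ν) →
    (∀ n, Integrable (fun v : V3 => ‖v‖ ^ 3) (νs n : Measure V3) ∧
      ∫ v, ‖v‖ ^ 3 ∂(νs n : Measure V3) ≤ M) →
    (Integrable (fun v : V3 => ‖v‖ ^ 3) (ν : Measure V3) ∧ ∫ v, ‖v‖ ^ 3 ∂(ν : Measure V3) ≤ M) ∧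
    (∀ j : Fin 3, Tendsto (fun n => ∫ v, v j ∂(νs n : Measure V3)) atTop (𝓝 (∫ v, v j ∂(ν : Measure V3)))) ∧
    (∀ j k : Fin 3, Tendsto (fun n => ∫ v, v j * v k ∂(νs n : Measure V3)) atTop
      (𝓝 (∫ v, v j * v k ∂(ν : Measure V3)))) ∧
    (∀ Ξ : (V3 × V3) × Metric.sphere (0 : V3) 1 → ℝ, Continuous Ξ → (∀ q, 0 ≤ Ξ q) →
      (∃ C : ℝ, ∀ q, Ξ q ≤ C) → ∀ (b : ℕ → ℝ) (c : ℝ), Tendsto b atTop (𝓝 c) →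
      (∀ n, ∫ q, Ξ q * hardSphereKernel (q.1.2, q.1.1) q.2
          ∂(((νs n : Measure V3).prod (νs n : Measure V3)).prod sphereMeasure) ≤ b n) →
      ∫ q, Ξ q * hardSphereKernel (q.1.2, q.1.1) q.2
          ∂(((ν : Measure V3).prod (ν : Measure V3)).prod sphereMeasure) ≤ c)) ∧
  (∀ (M : ℝ) (κs : ℕ → FiniteMeasure ((V3 × V3) × Metric.sphere (0 : V3) 1))
    (κ : FiniteMeasure ((V3 × V3) × Metric.sphere (0 : V3) 1)), Tendsto κs atTop (𝓝 κ) →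
    (∀ n, Integrable (fun q : (V3 × V3) × Metric.sphere (0 : V3) 1 => ‖q.1.1‖ ^ 2 + ‖q.1.2‖ ^ 2)
        (κs n : Measure ((V3 × V3) × Metric.sphere (0 : V3) 1)) ∧
      ∫ q, (‖q.1.1‖ ^ 2 + ‖q.1.2‖ ^ 2) ∂(κs n : Measure ((V3 × V3) × Metric.sphere (0 : V3) 1)) ≤ M ∧
      ((κs n : Measure ((V3 × V3) × Metric.sphere (0 : V3) 1)) Set.univ).toReal ≤ M) →
    Integrable (fun q : (V3 × V3) × Metric.sphere (0 : V3) 1 => ‖q.1.1‖ ^ 2 + ‖q.1.2‖ ^ 2)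
        (κ : Measure ((V3 × V3) × Metric.sphere (0 : V3) 1)) ∧
      ∫ q, (‖q.1.1‖ ^ 2 + ‖q.1.2‖ ^ 2) ∂(κ : Measure ((V3 × V3) × Metric.sphere (0 : V3) 1)) ≤ M ∧
      ((κ : Measure ((V3 × V3) × Metric.sphere (0 : V3) 1)) Set.univ).toReal ≤ M)

/-! ### §1 Generic transfer lemmas along finite measures tested on bounded continuous functions -/

section Generic

variable {Ω : Type*} [MeasurableSpace Ω] [TopologicalSpace Ω] [OpensMeasurableSpace Ω]

omit [TopologicalSpace Ω] [OpensMeasurableSpace Ω] in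
/-- Monotone convergence for the truncations `f ∧ k`, `k ∈ ℕ`:
`∫⁻ f⁺ dμ = ⨆_k ∫⁻ (f ∧ k)⁺ dμ`. [folklore] -/
theorem lintegral_ofReal_eq_iSup_trunc (μ : Measure Ω) {f : Ω → ℝ} (hf : Measurable f) :
    ∫⁻ x, ENNReal.ofReal (f x) ∂μ = ⨆ k : ℕ, ∫⁻ x, ENNReal.ofReal (min (f x) k) ∂μ := by
  rw [← lintegral_iSup (fun k => (hf.min measurable_const).ennreal_ofReal)
    (fun k l hkl x => ENNReal.ofReal_le_ofReal (min_le_min_left _ (Nat.cast_le.2 hkl)))]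
  refine lintegral_congr fun x => le_antisymm ?_
    (iSup_le fun k => ENNReal.ofReal_le_ofReal (min_le_left _ _))
  obtain ⟨k, hk⟩ := exists_nat_ge (f x)
  exact le_iSup_of_le k (by rw [min_eq_left hk])

/-- A continuous function bounded in absolute value is integrable against a finite measure. [folklore] -/
theorem integrable_of_abs_le (μ : Measure Ω) [IsFiniteMeasure μ] {g : Ω → ℝ} (hg : Continuous g)
    {C : ℝ} (hC : ∀ x, |g x| ≤ C) : Integrable g μ :=
  (integrable_const C).mono' hg.aestronglyMeasurable
    (Eventually.of_forall fun x => by rw [Real.norm_eq_abs]; exact hC x)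

/-- **Lower semicontinuity of `μ ↦ ∫ f dμ` for continuous `f ≥ 0`.**  If `∫ g dμ_n → ∫ g dμ` for every
bounded continuous `g` (finite measures), `f ≥ 0` is continuous and `μ_n`-integrable with
`∫ f dμ_n ≤ b_n`, `b_n → c`, then `f` is `μ`-integrable and `∫ f dμ ≤ c`.  Proof: `∫ (f ∧ k) dμ ≤ c` for
every `k` (bounded continuous test), then monotone convergence in `k`. [folklore] -/
theorem integrable_and_integral_le_of_forall_tendsto
    {μs : ℕ → Measure Ω} {μ : Measure Ω} [IsFiniteMeasure μ] [∀ n, IsFiniteMeasure (μs n)]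
    (H : ∀ g : Ω → ℝ, Continuous g → (∃ C : ℝ, ∀ x, |g x| ≤ C) →
      Tendsto (fun n => ∫ x, g x ∂μs n) atTop (𝓝 (∫ x, g x ∂μ)))
    {f : Ω → ℝ} (hf : Continuous f) (hf0 : ∀ x, 0 ≤ f x) (hfi : ∀ n, Integrable f (μs n))
    {b : ℕ → ℝ} {c : ℝ} (hb : Tendsto b atTop (𝓝 c)) (hle : ∀ n, ∫ x, f x ∂μs n ≤ b n) :
    Integrable f μ ∧ ∫ x, f x ∂μ ≤ c := by
  have hc0 : 0 ≤ c := ge_of_tendsto' hb fun n => (integral_nonneg fun x => hf0 x).trans (hle n)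
  -- the truncations `f ∧ k` are bounded, continuous and nonnegative
  have hgc : ∀ k : ℕ, Continuous fun x => min (f x) k := fun k => hf.min continuous_const
  have hg0 : ∀ (k : ℕ) (x : Ω), 0 ≤ min (f x) k := fun k x => le_min (hf0 x) k.cast_nonneg
  have hgb : ∀ (k : ℕ) (x : Ω), |min (f x) k| ≤ k := fun k x => by
    rw [abs_of_nonneg (hg0 k x)]; exact min_le_right _ _
  -- `∫ (f ∧ k) dμ ≤ c` for every `k`
  have hgk : ∀ k : ℕ, ∫ x, min (f x) k ∂μ ≤ c := fun k =>
    le_of_tendsto_of_tendsto' (H _ (hgc k) ⟨k, hgb k⟩) hb fun n =>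
      (integral_mono_of_nonneg (Eventually.of_forall (hg0 k)) (hfi n)
        (Eventually.of_forall fun x => min_le_left _ _)).trans (hle n)
  -- monotone convergence in `k`
  have key : ∫⁻ x, ENNReal.ofReal (f x) ∂μ ≤ ENNReal.ofReal c := by
    rw [lintegral_ofReal_eq_iSup_trunc μ hf.measurable]
    refine iSup_le fun k => ?_
    rw [← ofReal_integral_eq_lintegral_ofReal (integrable_of_abs_le μ (hgc k) (hgb k))
      (Eventually.of_forall (hg0 k))]
    exact ENNReal.ofReal_le_ofReal (hgk k)
  refine ⟨⟨hf.aestronglyMeasurable, ?_⟩, ?_⟩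
  · rw [hasFiniteIntegral_iff_ofReal (Eventually.of_forall hf0)]
    exact key.trans_lt ENNReal.ofReal_lt_top
  · rw [integral_eq_lintegral_of_nonneg_ae (Eventually.of_forall hf0) hf.aestronglyMeasurable]
    exact ENNReal.toReal_le_of_le_ofReal hc0 key

/-- **Transfer of `∫ f` under a uniformly integrable domination.**  If `∫ g dμ_n → ∫ g dμ` for every
bounded continuous `g` (finite measures), the weight `w` has `∫ w dμ_n ≤ M` and `∫ w dμ ≤ M`, and the
continuous `f` is, for every `ε > 0`, within `ε w` of a bounded continuous function, then
`∫ f dμ_n → ∫ f dμ` (`3ε` argument). [folklore] -/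
theorem tendsto_integral_of_forall_approx
    {μs : ℕ → Measure Ω} {μ : Measure Ω} [IsFiniteMeasure μ] [∀ n, IsFiniteMeasure (μs n)]
    (H : ∀ g : Ω → ℝ, Continuous g → (∃ C : ℝ, ∀ x, |g x| ≤ C) →
      Tendsto (fun n => ∫ x, g x ∂μs n) atTop (𝓝 (∫ x, g x ∂μ)))
    {w : Ω → ℝ} {M : ℝ} (hwn : ∀ n, Integrable w (μs n)) (hwnM : ∀ n, ∫ x, w x ∂μs n ≤ M)
    (hw : Integrable w μ) (hwM : ∫ x, w x ∂μ ≤ M) {f : Ω → ℝ} (hf : Continuous f)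
    (happrox : ∀ ε : ℝ, 0 < ε → ∃ g : Ω → ℝ, Continuous g ∧ (∃ C : ℝ, ∀ x, |g x| ≤ C) ∧
      ∀ x, |f x - g x| ≤ ε * w x) :
    Tendsto (fun n => ∫ x, f x ∂μs n) atTop (𝓝 (∫ x, f x ∂μ)) := by
  rw [Metric.tendsto_atTop]
  intro ε hε
  set δ : ℝ := ε / (3 * (|M| + 1)) with hδ
  have hδ0 : 0 < δ := by positivity
  have hδM : δ * M ≤ ε / 3 :=
    calc δ * M ≤ δ * (|M| + 1) := by gcongr; exact (le_abs_self M).trans (lt_add_one _).le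
      _ = ε / 3 := by rw [hδ]; field_simp
  obtain ⟨g, hg, ⟨C, hC⟩, hfg⟩ := happrox δ hδ0
  -- the key estimate, for every finite measure with `∫ w ≤ M`
  have hest : ∀ (ρ : Measure Ω) [IsFiniteMeasure ρ], Integrable w ρ → ∫ x, w x ∂ρ ≤ M →
      |∫ x, f x ∂ρ - ∫ x, g x ∂ρ| ≤ ε / 3 := by
    intro ρ _ hwρ hwρM
    have hgρ : Integrable g ρ := integrable_of_abs_le ρ hg hC
    have hdρ : Integrable (fun x => f x - g x) ρ :=
      (hwρ.const_mul δ).mono' (hf.sub hg).aestronglyMeasurable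
        (Eventually.of_forall fun x => by rw [Real.norm_eq_abs]; exact hfg x)
    have hfρ : Integrable f ρ := (hdρ.add hgρ).congr (Eventually.of_forall fun x => by simp)
    rw [← integral_sub hfρ hgρ]
    calc |∫ x, (f x - g x) ∂ρ| ≤ ∫ x, |f x - g x| ∂ρ := abs_integral_le_integral_abs
      _ ≤ ∫ x, δ * w x ∂ρ := integral_mono_of_nonneg (Eventually.of_forall fun x => abs_nonneg _)
          (hwρ.const_mul δ) (Eventually.of_forall hfg)
      _ = δ * ∫ x, w x ∂ρ := integral_const_mul δ _
      _ ≤ δ * M := by gcongr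
      _ ≤ ε / 3 := hδM
  obtain ⟨N, hN⟩ := Metric.tendsto_atTop.1 (H g hg ⟨C, hC⟩) (ε / 3) (by positivity)
  refine ⟨N, fun n hn => ?_⟩
  have e1 := hest (μs n) (hwn n) (hwnM n)
  have e2 := hest μ hw hwM
  have e3 := hN n hn
  rw [Real.dist_eq] at e3 ⊢
  have t1 := abs_sub_le (∫ x, f x ∂μs n) (∫ x, g x ∂μs n) (∫ x, f x ∂μ)
  have t2 := abs_sub_le (∫ x, g x ∂μs n) (∫ x, g x ∂μ) (∫ x, f x ∂μ)
  rw [abs_sub_comm (∫ x, g x ∂μ) (∫ x, f x ∂μ)] at t2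
  linarith

/-- Weak convergence of finite measures, tested on plain bounded continuous functions. [folklore] -/
theorem tendsto_integral_of_tendsto_finiteMeasure {μs : ℕ → FiniteMeasure Ω} {μ : FiniteMeasure Ω}
    (h : Tendsto μs atTop (𝓝 μ)) (g : Ω → ℝ) (hg : Continuous g) (hC : ∃ C : ℝ, ∀ x, |g x| ≤ C) :
    Tendsto (fun n => ∫ x, g x ∂(μs n : Measure Ω)) atTop (𝓝 (∫ x, g x ∂(μ : Measure Ω))) := by
  obtain ⟨C, hC⟩ := hC
  exact FiniteMeasure.tendsto_iff_forall_integral_tendsto.1 h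
    (BoundedContinuousFunction.ofNormedAddCommGroup g hg C fun x => by
      rw [Real.norm_eq_abs]; exact hC x)

/-- Weak convergence of probability measures, tested on plain bounded continuous functions. [folklore] -/
theorem tendsto_integral_of_tendsto_probabilityMeasure {μs : ℕ → ProbabilityMeasure Ω}
    {μ : ProbabilityMeasure Ω} (h : Tendsto μs atTop (𝓝 μ)) (g : Ω → ℝ) (hg : Continuous g)
    (hC : ∃ C : ℝ, ∀ x, |g x| ≤ C) :
    Tendsto (fun n => ∫ x, g x ∂(μs n : Measure Ω)) atTop (𝓝 (∫ x, g x ∂(μ : Measure Ω))) :=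
  tendsto_integral_of_tendsto_finiteMeasure
    ((ProbabilityMeasure.tendsto_nhds_iff_toFiniteMeasure_tendsto_nhds _).1 h) g hg hC

end Generic

/-! ### §2 Bounds on `ℝ³` and on the record space `Q = (ℝ³ × ℝ³) × S²` -/

/-- `|v_j| ≤ 1 + |v|²`. [folklore] -/
theorem abs_coord_le (j : Fin 3) (v : V3) : |v j| ≤ 1 + ‖v‖ ^ 2 := by
  have h1 : |v j| ≤ ‖v‖ := by rw [← Real.norm_eq_abs]; exact PiLp.norm_apply_le v j
  nlinarith [sq_nonneg (‖v‖ - 1), norm_nonneg v]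

/-- `|v_j v_k| ≤ 1 + |v|²`. [folklore] -/
theorem abs_coord_mul_le (j k : Fin 3) (v : V3) : |v j * v k| ≤ 1 + ‖v‖ ^ 2 := by
  have hj : |v j| ≤ ‖v‖ := by rw [← Real.norm_eq_abs]; exact PiLp.norm_apply_le v j
  have hk : |v k| ≤ ‖v‖ := by rw [← Real.norm_eq_abs]; exact PiLp.norm_apply_le v k
  rw [abs_mul]
  nlinarith [abs_nonneg (v j), abs_nonneg (v k), mul_le_mul hj hk (abs_nonneg _) (norm_nonneg _)]

/-- **Radial cutoff.**  A continuous `f` on `ℝ³` with `|f| ≤ 1 + |v|²` is, for every `ε > 0`, within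
`ε |v|³` of a bounded continuous function: `g = f χ_R` with `χ_R(v) = 0 ∨ (1 ∧ (2 − |v|/R))`,
`R = 1 ∨ 2/ε`; off the ball of radius `R ≥ 1` one has `1 + |v|² ≤ 2|v|² ≤ (2/R)|v|³`. [folklore] -/
theorem exists_approx_of_abs_le {f : V3 → ℝ} (hf : Continuous f) (hfb : ∀ v, |f v| ≤ 1 + ‖v‖ ^ 2)
    (ε : ℝ) (hε : 0 < ε) :
    ∃ g : V3 → ℝ, Continuous g ∧ (∃ C : ℝ, ∀ v, |g v| ≤ C) ∧ ∀ v, |f v - g v| ≤ ε * ‖v‖ ^ 3 := by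
  -- cutoff radius `R ≥ 1` with `2 / R ≤ ε`
  obtain ⟨R, hR1, hRε⟩ : ∃ R : ℝ, 1 ≤ R ∧ 2 / R ≤ ε := by
    refine ⟨max 1 (2 / ε), le_max_left _ _, ?_⟩
    rw [div_le_iff₀ (by positivity)]
    calc (2 : ℝ) = ε * (2 / ε) := by field_simp
      _ ≤ ε * max 1 (2 / ε) := by gcongr; exact le_max_right _ _
  have hR0 : 0 < R := one_pos.trans_le hR1
  -- the cutoff `χ`
  set χ : V3 → ℝ := fun v => max 0 (min 1 (2 - ‖v‖ / R)) with hχ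
  have hχc : Continuous χ := by rw [hχ]; fun_prop
  have hχ0 : ∀ v, 0 ≤ χ v := fun v => le_max_left _ _
  have hχ1 : ∀ v, χ v ≤ 1 := fun v => max_le zero_le_one (min_le_left _ _)
  have hχin : ∀ v, ‖v‖ ≤ R → χ v = 1 := fun v hv => by
    have h1 : ‖v‖ / R ≤ 1 := (div_le_one hR0).2 hv
    show max 0 (min 1 (2 - ‖v‖ / R)) = 1
    rw [min_eq_left (by linarith), max_eq_right zero_le_one]
  have hχout : ∀ v, 2 * R ≤ ‖v‖ → χ v = 0 := fun v hv => by
    have h1 : 2 ≤ ‖v‖ / R := (le_div_iff₀ hR0).2 hv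
    show max 0 (min 1 (2 - ‖v‖ / R)) = 0
    exact max_eq_left (min_le_of_right_le (by linarith))
  refine ⟨fun v => f v * χ v, hf.mul hχc, ⟨1 + (2 * R) ^ 2, fun v => ?_⟩, fun v => ?_⟩
  · -- boundedness of `f χ`
    show |f v * χ v| ≤ 1 + (2 * R) ^ 2
    rcases le_or_gt ‖v‖ (2 * R) with h | h
    · rw [abs_mul, abs_of_nonneg (hχ0 v)]
      calc |f v| * χ v ≤ (1 + ‖v‖ ^ 2) * 1 := mul_le_mul (hfb v) (hχ1 v) (hχ0 v) (by positivity)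
        _ ≤ 1 + (2 * R) ^ 2 := by rw [mul_one]; gcongr
    · rw [hχout v h.le, mul_zero, abs_zero]; positivity
  · -- the remainder `f (1 - χ)` lives off the ball of radius `R`
    show |f v - f v * χ v| ≤ ε * ‖v‖ ^ 3
    rcases le_or_gt ‖v‖ R with h | h
    · rw [hχin v h, mul_one, sub_self, abs_zero]; positivity
    · have e1 : |f v - f v * χ v| ≤ |f v| := by
        rw [← mul_one_sub, abs_mul]
        refine mul_le_of_le_one_right (abs_nonneg _) ?_
        rw [abs_of_nonneg (sub_nonneg.2 (hχ1 v))]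
        exact sub_le_self _ (hχ0 v)
      have hv1 : 1 ≤ ‖v‖ := hR1.trans h.le
      calc |f v - f v * χ v| ≤ 1 + ‖v‖ ^ 2 := e1.trans (hfb v)
        _ ≤ 2 / R * ‖v‖ ^ 3 := by
            rw [div_mul_eq_mul_div, le_div_iff₀ hR0]
            calc (1 + ‖v‖ ^ 2) * R ≤ 2 * ‖v‖ ^ 2 * R :=
                  mul_le_mul_of_nonneg_right (by nlinarith) hR0.le
              _ ≤ 2 * ‖v‖ ^ 2 * ‖v‖ := mul_le_mul_of_nonneg_left h.le (by positivity)
              _ = 2 * ‖v‖ ^ 3 := by ring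
        _ ≤ ε * ‖v‖ ^ 3 := by gcongr

/-- The flux weight is at most `|v| + |w|` (Cauchy–Schwarz with `‖ω‖ = 1`). [folklore] -/
theorem fluxWeightQ_le (q : (V3 × V3) × Metric.sphere (0 : V3) 1) :
    hardSphereKernel (q.1.2, q.1.1) q.2 ≤ ‖q.1.1‖ + ‖q.1.2‖ := by
  unfold hardSphereKernel
  refine max_le ?_ (by positivity)
  calc ⟪q.1.2 - q.1.1, (q.2 : V3)⟫_ℝ ≤ ‖q.1.2 - q.1.1‖ * ‖(q.2 : V3)‖ := real_inner_le_norm _ _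
    _ = ‖q.1.2 - q.1.1‖ := by rw [norm_eq_of_mem_sphere q.2, mul_one]
    _ ≤ ‖q.1.2‖ + ‖q.1.1‖ := norm_sub_le _ _
    _ = ‖q.1.1‖ + ‖q.1.2‖ := add_comm _ _

/-- **The floor integrand is integrable against `(μ ⊗ μ) ⊗ σ`** when `μ` is a finite measure on `ℝ³` with
finite third moment: `0 ≤ Ξ B ≤ C (|v| + |w|) ≤ C (2 + |v|³ + |w|³)` (`t ≤ 1 + t³` for `t ≥ 0`); `B` is
continuous and nonnegative (`ParityBandClosureIsotropy.continuous_fluxWeight`, `fluxWeight_nonneg`,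
p139366). [folklore] -/
theorem integrable_mul_fluxWeightQ (μ : Measure V3) [IsFiniteMeasure μ]
    {Ξ : (V3 × V3) × Metric.sphere (0 : V3) 1 → ℝ} (hΞc : Continuous Ξ) (hΞ0 : ∀ q, 0 ≤ Ξ q)
    (hΞC : ∃ C : ℝ, ∀ q, Ξ q ≤ C) (h3 : Integrable (fun v : V3 => ‖v‖ ^ 3) μ) :
    Integrable (fun q : (V3 × V3) × Metric.sphere (0 : V3) 1 =>
      Ξ q * hardSphereKernel (q.1.2, q.1.1) q.2) ((μ.prod μ).prod sphereMeasure) := by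
  haveI : IsFiniteMeasure (sphereMeasure : Measure (Metric.sphere (0 : V3) 1)) := by
    unfold sphereMeasure; infer_instance
  obtain ⟨C, hC⟩ := hΞC
  have h1 : Integrable (fun q : (V3 × V3) × Metric.sphere (0 : V3) 1 => ‖q.1.1‖ ^ 3)
      ((μ.prod μ).prod sphereMeasure) := (h3.comp_fst μ).comp_fst sphereMeasure
  have h2 : Integrable (fun q : (V3 × V3) × Metric.sphere (0 : V3) 1 => ‖q.1.2‖ ^ 3)
      ((μ.prod μ).prod sphereMeasure) := (h3.comp_snd μ).comp_fst sphereMeasure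
  refine ((((integrable_const (2 : ℝ)).add h1).add h2).const_mul C).mono'
    (hΞc.mul ParityBandClosureIsotropy.continuous_fluxWeight).aestronglyMeasurable
    (Eventually.of_forall fun q => ?_)
  have hB0 := ParityBandClosureIsotropy.fluxWeight_nonneg (q.1.2, q.1.1) q.2
  have hC0 : 0 ≤ C := (hΞ0 q).trans (hC q)
  rw [Real.norm_eq_abs, abs_of_nonneg (mul_nonneg (hΞ0 q) hB0)]
  calc Ξ q * hardSphereKernel (q.1.2, q.1.1) q.2 ≤ C * (‖q.1.1‖ + ‖q.1.2‖) :=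
        mul_le_mul (hC q) (fluxWeightQ_le q) hB0 hC0
    _ ≤ C * (2 + ‖q.1.1‖ ^ 3 + ‖q.1.2‖ ^ 3) := by
        refine mul_le_mul_of_nonneg_left ?_ hC0
        nlinarith [mul_nonneg (norm_nonneg q.1.1) (sq_nonneg (‖q.1.1‖ - 1)),
          sq_nonneg (‖q.1.1‖ - 1 / 2), mul_nonneg (norm_nonneg q.1.2) (sq_nonneg (‖q.1.2‖ - 1)),
          sq_nonneg (‖q.1.2‖ - 1 / 2)]

/-! ### §3 Weak convergence of the products `P_n ⊗ σ` for the fixed finite `σ` on the sphere -/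

/-- **Products with the fixed sphere measure.**  If `P_n → P` weakly (probability measures on `ℝ³ × ℝ³`),
then `∫ g d(P_n ⊗ σ) → ∫ g d(P ⊗ σ)` for every bounded continuous `g` on `Q`: by Fubini the integral is
`∫ G dP_n` with `G x = ∫ g (x, ω) dσ(ω)` bounded and continuous (dominated convergence). [folklore] -/
theorem tendsto_integral_prod_sphereMeasure {Ps : ℕ → ProbabilityMeasure (V3 × V3)}
    {P : ProbabilityMeasure (V3 × V3)} (hP : Tendsto Ps atTop (𝓝 P))
    (g : (V3 × V3) × Metric.sphere (0 : V3) 1 → ℝ) (hg : Continuous g) (hC : ∃ C : ℝ, ∀ q, |g q| ≤ C) :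
    Tendsto (fun n => ∫ q, g q ∂((Ps n : Measure (V3 × V3)).prod sphereMeasure)) atTop
      (𝓝 (∫ q, g q ∂((P : Measure (V3 × V3)).prod sphereMeasure))) := by
  haveI : IsFiniteMeasure (sphereMeasure : Measure (Metric.sphere (0 : V3) 1)) := by
    unfold sphereMeasure; infer_instance
  obtain ⟨C, hC⟩ := hC
  -- Fubini
  have hfub : ∀ (ρ : Measure (V3 × V3)) [IsFiniteMeasure ρ],
      ∫ q, g q ∂(ρ.prod sphereMeasure) = ∫ x, (∫ ω, g (x, ω) ∂sphereMeasure) ∂ρ := fun ρ _ =>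
    integral_prod g (integrable_of_abs_le _ hg hC)
  -- the inner integral is bounded and continuous
  have hGc : Continuous fun x : V3 × V3 => ∫ ω, g (x, ω) ∂sphereMeasure :=
    continuous_of_dominated (F := fun (x : V3 × V3) ω => g (x, ω)) (bound := fun _ => C)
      (fun x => (hg.comp (Continuous.prodMk_right x)).aestronglyMeasurable)
      (fun x => Eventually.of_forall fun ω => by rw [Real.norm_eq_abs]; exact hC _)
      (integrable_const C) (Eventually.of_forall fun ω => hg.comp (Continuous.prodMk_left ω))
  have hGb : ∀ x : V3 × V3, |∫ ω, g (x, ω) ∂sphereMeasure| ≤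
      C * (sphereMeasure : Measure (Metric.sphere (0 : V3) 1)).real Set.univ := fun x => by
    rw [← Real.norm_eq_abs]
    exact norm_integral_le_of_norm_le_const (Eventually.of_forall fun ω => by
      rw [Real.norm_eq_abs]; exact hC _)
  rw [hfub]
  refine (tendsto_integral_of_tendsto_probabilityMeasure hP _ hGc ⟨_, hGb⟩).congr fun n => ?_
  exact (hfub _).symm

/-! ### §4 The waypoint -/

/-- **`MomentSemicontinuity` (waypoint of `ParityStability`, skeleton v3 of `transfer-weighted-parity-chain`).**
ν-part: cubic moment bound, convergence of first/second coordinate moments, lower semicontinuity of the floor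
integral `∫ Ξ B d((ν ⊗ ν) ⊗ σ)` along `ν_n → ν`; κ-part: second moments and mass pass to weak limits.  Assembled
from §1 (truncation + monotone convergence; transfer under the cubic domination), §2 and §3. [folklore] -/
theorem stub_momentSemicontinuity : MomentSemicontinuity := by
  haveI hσ : IsFiniteMeasure (sphereMeasure : Measure (Metric.sphere (0 : V3) 1)) := by
    unfold sphereMeasure; infer_instance
  refine ⟨fun M νs ν hν hb => ?_, fun M κs κ hκ hb => ?_⟩
  · -- ν-part
    have Hν := tendsto_integral_of_tendsto_probabilityMeasure hν
    have h3 : Integrable (fun v : V3 => ‖v‖ ^ 3) (ν : Measure V3) ∧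
        ∫ v, ‖v‖ ^ 3 ∂(ν : Measure V3) ≤ M :=
      integrable_and_integral_le_of_forall_tendsto Hν (continuous_norm.pow 3)
        (fun v => pow_nonneg (norm_nonneg v) 3)
        (fun n => (hb n).1) tendsto_const_nhds (fun n => (hb n).2)
    refine ⟨h3, fun j => ?_, fun j k => ?_, fun Ξ hΞc hΞ0 hΞC b c hbc hfl => ?_⟩
    · -- first moments
      exact tendsto_integral_of_forall_approx Hν (fun n => (hb n).1) (fun n => (hb n).2) h3.1 h3.2
        (PiLp.continuous_apply 2 _ j)
        (exists_approx_of_abs_le (PiLp.continuous_apply 2 _ j) (abs_coord_le j))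
    · -- second moments
      exact tendsto_integral_of_forall_approx Hν (fun n => (hb n).1) (fun n => (hb n).2) h3.1 h3.2
        ((PiLp.continuous_apply 2 _ j).mul (PiLp.continuous_apply 2 _ k))
        (exists_approx_of_abs_le ((PiLp.continuous_apply 2 _ j).mul (PiLp.continuous_apply 2 _ k))
          (abs_coord_mul_le j k))
    · -- lower semicontinuity of the floor integral along `(ν_n ⊗ ν_n) ⊗ σ → (ν ⊗ ν) ⊗ σ`
      have hP : Tendsto (fun n => (νs n).prod (νs n)) atTop (𝓝 (ν.prod ν)) :=
        (ProbabilityMeasure.continuous_prod.tendsto (ν, ν)).comp (hν.prodMk_nhds hν)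
      exact (integrable_and_integral_le_of_forall_tendsto (tendsto_integral_prod_sphereMeasure hP)
        (hΞc.mul ParityBandClosureIsotropy.continuous_fluxWeight)
        (fun q => mul_nonneg (hΞ0 q) (ParityBandClosureIsotropy.fluxWeight_nonneg (q.1.2, q.1.1) q.2))
        (fun n => integrable_mul_fluxWeightQ _ hΞc hΞ0 hΞC (hb n).1) hbc hfl).2
  · -- κ-part
    have h2 := integrable_and_integral_le_of_forall_tendsto (tendsto_integral_of_tendsto_finiteMeasure hκ)
      (by fun_prop : Continuous fun q : (V3 × V3) × Metric.sphere (0 : V3) 1 => ‖q.1.1‖ ^ 2 + ‖q.1.2‖ ^ 2)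
      (fun q => by positivity) (fun n => (hb n).1) tendsto_const_nhds (fun n => (hb n).2.1)
    refine ⟨h2.1, h2.2, ?_⟩
    have hmass : ∀ ρ : FiniteMeasure ((V3 × V3) × Metric.sphere (0 : V3) 1),
        ((ρ : Measure ((V3 × V3) × Metric.sphere (0 : V3) 1)) Set.univ).toReal = (ρ.mass : ℝ) :=
      fun ρ => by rw [← FiniteMeasure.ennreal_mass, ENNReal.coe_toReal]
    have hmn : ∀ n, ((κs n).mass : ℝ) ≤ M := fun n => by rw [← hmass]; exact (hb n).2.2
    rw [hmass]
    exact le_of_tendsto' (NNReal.tendsto_coe.2 ((FiniteMeasure.continuous_mass.tendsto κ).comp hκ)) hmn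

end Summit.AtomisticToContinuum.HydrodynamicLimit.Theorems.ParityBandClosureMomentSemicontinuity

end
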